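/-
Origin: expansion seat `planner-pub-hodgecm-prl1-g12-0`, handover #7 2026-08-18T20:36Z md5 96f2dfaa739cd638cd3cd5be3cbfd6e2 (NEW additive leaf, 214 l., junction J2c′ = unfolding / piece projection of `pieceEmb` against a global `v ∈ Q.H` + regime wrappers; imports glue-1 #29 `HodgeCM.Model.Junction.PieceEmbedding` + row #6; KERNEL only: 10 theorems 0 defs 0 records 0 hypotheses beyond data; `#print axioms` 8/8 ⊆ {propext, Classical.choice, Quot.sound}; rehearsal (`HOME/pub-hodgecm-prl1-g12/aslanded/HodgeCM/Model/Junction/PieceUnfolding.lean`, md5 96f2dfaa, 214 lines);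
landed by the packager successor (mc-unitary-1-g3, gen-8 kit) in gate run 32 as `HodgeCM/Model/Junction/PieceUnfolding.lean` (verbatim).
-/
/-
Origin: speedrun cell pub-hodgecm, unit pub-hodgecm-prl1-g12 (PerL-residual KEPT seat gen 12, END-STATE owner; node
E4-unfold = the E-lane half of junction J2c), seat planner-pub-hodgecm-prl1-g12-0, 2026-08-18.
Target in PKG: HodgeCM/Model/Junction/PieceUnfolding.lean (NEW additive leaf; nothing landed imports it).
P0 NOTE: imports mc-glue-1's junction J2c `PieceEmbedding` (kit row #29) and the vendored harness-tree module
`LevelOrbitUnfolding` (this unit's tree file, vendored under `HodgeCM.Vendored.H21`).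
-/
import Summits.HodgeConjecture.HodgeCM.Model.Junction.PieceEmbedding
import Literature.NumberTheory.Automorphic.LevelOrbitUnfolding

/-!
# Junction J2c′: unfolding the piece embedding against a global `L²` class

`PieceEmbedding` (J2c) computes `⟪pieceEmb f', pieceEmb f⟫` for two functions on the SAME arithmetic quotient.
The binders' ₁₀ obligations (`Gen12FunBridge.proj` / `SeesawFunBridge.Λ_proj`, C5′; the projection step of C6′)
pair a piece-embedded class with a GLOBAL element `v ∈ Q.H = L²(Q.G ⧸ Q.Γ)` (a theta product).  Transporting the
tree's single-piece unfolding (`LevelOrbit.inner_pieceLiftLp_left` and its corollaries, Getz–Hahn (6.8)/(2.14))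
along the `L²` transport of J2 gives, for `v` agreeing a.e. on the piece `M • x` (read through `cosetCongr e`)
with a `ker π`-invariant function `u` on `G₁ ⧸ Γ₁`:

* `inner_pieceEmb_left` : `⟪pieceEmb f, v⟫ = ∫ ⟪f q, pieceDescend u q⟫ ∂μ₁` (unfolding);
* `inner_pieceEmb_left_eq_inner_pieceEmb` : `⟪pieceEmb (pieceDescendCM u), v⟫ = ⟪pieceEmb (pieceDescendCM u),
  pieceEmb (pieceDescendCM u)⟫` — the PIECE PROJECTION identity `⟪𝟙_P v, v⟫ = ‖𝟙_P v‖²` in the form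
  `Gen12FunBridge.proj_of_eq_smul` / `inner_eq_mul_inner_self_of_eq_smul` consume (`⟪p, w⟫ = ⟪p, p⟫`);
* `inner_pieceEmb_pieceDescendCM_left` : its value `∫_{M • x} ‖u‖² d(pullbackν)`, and
  `inner_pieceEmb_pieceDescendCM_left_ne_zero_iff_exists` : `≠ 0 ↔ u ≢ 0` on the piece (open-positive measure).

Everything is proved; 0 hypotheses beyond the data; 0 MODEL-N.
-/

set_option autoImplicit false

noncomputable section

open MeasureTheory Literature.MeasureTheory.Group Literature.NumberTheory.Automorphic
open scoped ENNReal InnerProductSpace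

namespace HodgeCM

namespace QuotientModel

variable (Q : QuotientModel) {G₁ : Type*} [Group G₁] [TopologicalSpace G₁] [IsTopologicalGroup G₁]
  (Γ₁ : Subgroup G₁) (e : G₁ ≃ₜ* Q.G) (hΓ : ∀ g, e g ∈ Q.Γ ↔ g ∈ Γ₁)
  [MeasurableSpace (G₁ ⧸ Γ₁)] [BorelSpace (G₁ ⧸ Γ₁)]
  (M : Subgroup G₁) {A : Type*} [Group A] [TopologicalSpace A] [IsTopologicalGroup A] (π : M →* A)
  (hπs : Function.Surjective π) (x : G₁ ⧸ Γ₁)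
  [MeasurableSpace (A ⧸ LevelOrbit.pieceLattice M Γ₁ π x)]
  [BorelSpace (A ⧸ LevelOrbit.pieceLattice M Γ₁ π x)]
  [CompactSpace (A ⧸ LevelOrbit.pieceLattice M Γ₁ π x)]

omit [IsTopologicalGroup G₁] [IsTopologicalGroup A] in
/-- `v ∈ Q.H` read back on `G₁ ⧸ Γ₁`: if `v ∘ cosetCongr e = u` a.e. on the piece `M • x` (for `pullbackν`), then
`transportL2⁻¹ v = u` a.e. on the piece. -/
theorem transportL2_symm_congr_piece (v : Q.H) {u : G₁ ⧸ Γ₁ → ℂ}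
    (hvu : ∀ᵐ y ∂(Q.pullbackν Γ₁ e hΓ), y ∈ MulAction.orbit M x →
      (v : Q.G ⧸ Q.Γ → ℂ) (cosetCongr e.toMulEquiv Γ₁ Q.Γ hΓ y) = u y) :
    ∀ᵐ y ∂(Q.pullbackν Γ₁ e hΓ), y ∈ MulAction.orbit M x →
      ((Q.transportL2 Γ₁ e hΓ).symm v : G₁ ⧸ Γ₁ → ℂ) y = u y := by
  filter_upwards [Q.coeFn_transportL2_symm Γ₁ e hΓ v, hvu] with y hy hyu hmem
  rw [hy, Function.comp_apply, hyu hmem]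

omit [IsTopologicalGroup A] [MeasurableSpace (A ⧸ LevelOrbit.pieceLattice M Γ₁ π x)]
  [BorelSpace (A ⧸ LevelOrbit.pieceLattice M Γ₁ π x)] in
/-- `⟪pieceEmb f, v⟫_{Q.H} = ⟪pieceLiftLp f, transportL2⁻¹ v⟫_{L²(G₁ ⧸ Γ₁)}` (the transport is unitary). -/
theorem inner_pieceEmb_left_eq_inner_pieceLiftLp (hM : IsOpen (M : Set G₁)) (hπ : Continuous π)
    (f : C(A ⧸ LevelOrbit.pieceLattice M Γ₁ π x, ℂ)) (v : Q.H) :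
    ⟪Q.pieceEmb Γ₁ e hΓ M π x hM hπ f, v⟫_ℂ =
      ⟪LevelOrbit.pieceLiftLp ℂ M Γ₁ π x (Q.pullbackν Γ₁ e hΓ) 2 hM hπ f,
        (Q.transportL2 Γ₁ e hΓ).symm v⟫_ℂ := by
  conv_lhs => rw [pieceEmb_apply, ← (Q.transportL2 Γ₁ e hΓ).apply_symm_apply v]
  exact Q.inner_transportL2 Γ₁ e hΓ _ _

omit [IsTopologicalGroup A] in
/-- **Unfolding the piece embedding** (Getz–Hahn (6.8) + (2.14), transported): for `v ∈ Q.H` agreeing a.e. on the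
piece with a `ker π`-invariant `u`, `⟪pieceEmb f, v⟫ = ∫ ⟪f q, pieceDescend u q⟫ dμ₁`,
`μ₁ = pieceMeasure … (Q.pullbackν …)`. -/
theorem inner_pieceEmb_left (hM : IsOpen (M : Set G₁)) (hπ : Continuous π)
    (f : C(A ⧸ LevelOrbit.pieceLattice M Γ₁ π x, ℂ)) (v : Q.H) {u : G₁ ⧸ Γ₁ → ℂ}
    (hu : ∀ n : M, π n = 1 → ∀ y : G₁ ⧸ Γ₁, u (n • y) = u y)
    (hvu : ∀ᵐ y ∂(Q.pullbackν Γ₁ e hΓ), y ∈ MulAction.orbit M x →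
      (v : Q.G ⧸ Q.Γ → ℂ) (cosetCongr e.toMulEquiv Γ₁ Q.Γ hΓ y) = u y)
    (hum : AEStronglyMeasurable (LevelOrbit.pieceDescend M Γ₁ π hπs x u)
      (LevelOrbit.pieceMeasure M Γ₁ π x (Q.pullbackν Γ₁ e hΓ))) :
    ⟪Q.pieceEmb Γ₁ e hΓ M π x hM hπ f, v⟫_ℂ =
      ∫ q, ⟪f q, LevelOrbit.pieceDescend M Γ₁ π hπs x u q⟫_ℂ
        ∂(LevelOrbit.pieceMeasure M Γ₁ π x (Q.pullbackν Γ₁ e hΓ)) := by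
  rw [inner_pieceEmb_left_eq_inner_pieceLiftLp]
  exact LevelOrbit.inner_pieceLiftLp_left M Γ₁ π hπs x _ hM hπ f _ hu
    (Q.transportL2_symm_congr_piece Γ₁ e hΓ M x v hvu) hum

/-- **Piece projection** (`⟪p, w⟫ = ⟪p, p⟫`, the shape `Gen12FunBridge.proj_of_eq_smul` consumes): for `v ∈ Q.H`
agreeing a.e. on the piece `M • x` with a `ker π`-invariant `u` continuous on the piece, the piece-embedded descent
`p = pieceEmb (pieceDescendCM u)` satisfies `⟪p, v⟫ = ⟪p, p⟫`. -/
theorem inner_pieceEmb_left_eq_inner_pieceEmb (hM : IsOpen (M : Set G₁)) (hπc : Continuous π)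
    (hπo : IsOpenMap π) (v : Q.H) {u : G₁ ⧸ Γ₁ → ℂ}
    (hu : ∀ n : M, π n = 1 → ∀ y : G₁ ⧸ Γ₁, u (n • y) = u y)
    (huc : ContinuousOn u (MulAction.orbit M x))
    (hvu : ∀ᵐ y ∂(Q.pullbackν Γ₁ e hΓ), y ∈ MulAction.orbit M x →
      (v : Q.G ⧸ Q.Γ → ℂ) (cosetCongr e.toMulEquiv Γ₁ Q.Γ hΓ y) = u y) :
    ⟪Q.pieceEmb Γ₁ e hΓ M π x hM hπc (LevelOrbit.pieceDescendCM M Γ₁ π hM hπc hπo hπs x u hu huc), v⟫_ℂ =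
      ⟪Q.pieceEmb Γ₁ e hΓ M π x hM hπc (LevelOrbit.pieceDescendCM M Γ₁ π hM hπc hπo hπs x u hu huc),
        Q.pieceEmb Γ₁ e hΓ M π x hM hπc (LevelOrbit.pieceDescendCM M Γ₁ π hM hπc hπo hπs x u hu huc)⟫_ℂ := by
  rw [inner_pieceEmb_left_eq_inner_pieceLiftLp, pieceEmb_apply, inner_transportL2]
  exact LevelOrbit.inner_pieceLiftLp_left_eq_inner_pieceLiftLp M Γ₁ π hπs x _ hM hπc hπo _ _ hu huc
    (Q.transportL2_symm_congr_piece Γ₁ e hΓ M x v hvu)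

/-- **Value of the projected pairing**: `⟪pieceEmb (pieceDescendCM u), v⟫ = ∫_{M • x} ‖u‖² d(pullbackν)`. -/
theorem inner_pieceEmb_pieceDescendCM_left (hM : IsOpen (M : Set G₁)) (hπc : Continuous π)
    (hπo : IsOpenMap π) (v : Q.H) {u : G₁ ⧸ Γ₁ → ℂ}
    (hu : ∀ n : M, π n = 1 → ∀ y : G₁ ⧸ Γ₁, u (n • y) = u y)
    (huc : ContinuousOn u (MulAction.orbit M x))
    (hvu : ∀ᵐ y ∂(Q.pullbackν Γ₁ e hΓ), y ∈ MulAction.orbit M x →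
      (v : Q.G ⧸ Q.Γ → ℂ) (cosetCongr e.toMulEquiv Γ₁ Q.Γ hΓ y) = u y) :
    ⟪Q.pieceEmb Γ₁ e hΓ M π x hM hπc (LevelOrbit.pieceDescendCM M Γ₁ π hM hπc hπo hπs x u hu huc), v⟫_ℂ =
      ((∫ y in MulAction.orbit M x, ‖u y‖ ^ 2 ∂(Q.pullbackν Γ₁ e hΓ) : ℝ) : ℂ) := by
  rw [inner_pieceEmb_left_eq_inner_pieceLiftLp]
  exact LevelOrbit.inner_pieceLiftLp_pieceDescendCM_left M Γ₁ π hπs x _ hM hπc hπo _ hu huc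
    (Q.transportL2_symm_congr_piece Γ₁ e hΓ M x v hvu)

/-- **Non-vanishing of the projected pairing** (open-positive folded measure): `⟪pieceEmb (pieceDescendCM u), v⟫ ≠ 0`
iff `u` does not vanish identically on the piece `M • x`. -/
theorem inner_pieceEmb_pieceDescendCM_left_ne_zero_iff_exists [(Q.pullbackν Γ₁ e hΓ).IsOpenPosMeasure]
    (hM : IsOpen (M : Set G₁)) (hπc : Continuous π) (hπo : IsOpenMap π) (v : Q.H) {u : G₁ ⧸ Γ₁ → ℂ}
    (hu : ∀ n : M, π n = 1 → ∀ y : G₁ ⧸ Γ₁, u (n • y) = u y)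
    (huc : ContinuousOn u (MulAction.orbit M x))
    (hvu : ∀ᵐ y ∂(Q.pullbackν Γ₁ e hΓ), y ∈ MulAction.orbit M x →
      (v : Q.G ⧸ Q.Γ → ℂ) (cosetCongr e.toMulEquiv Γ₁ Q.Γ hΓ y) = u y) :
    ⟪Q.pieceEmb Γ₁ e hΓ M π x hM hπc (LevelOrbit.pieceDescendCM M Γ₁ π hM hπc hπo hπs x u hu huc), v⟫_ℂ ≠ 0 ↔
      ∃ y ∈ MulAction.orbit M x, u y ≠ 0 := by
  rw [inner_pieceEmb_left_eq_inner_pieceLiftLp]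
  exact LevelOrbit.inner_pieceLiftLp_pieceDescendCM_left_ne_zero_iff_exists M Γ₁ π hπs x _ hM hπc hπo _
    hu huc (Q.transportL2_symm_congr_piece Γ₁ e hΓ M x v hvu)

omit [IsTopologicalGroup G₁] [IsTopologicalGroup A] in
/-- `Q.ν` open-positive ⇒ so is its pull-back (for the instance hypothesis above). -/
theorem isOpenPosMeasure_pullbackν [Q.ν.IsOpenPosMeasure] : (Q.pullbackν Γ₁ e hΓ).IsOpenPosMeasure := by
  rw [pullbackν_def]
  exact isOpenPosMeasure_cosetPullback e.toMulEquiv Γ₁ Q.Γ hΓ e.continuous e.symm.continuous Q.ν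

end QuotientModel

/-! ## In PerL's regime: the END-STATE carrier `(V.latticeModel hP).toQuotientModel.H` -/

namespace HermSpace3

open HodgeCM.Adelic

variable (hP : PrintFact_unitaryCompact) {L : CMField} {ι₁ : L →+* ℂ} (V : HermSpace3 L ι₁)
  (h : IsAnisotropic L V.Hm)
  [MeasurableSpace (adelicUnitaryGroup L V.Hm ⧸ adelicUnitaryRat L V.Hm)]
  [BorelSpace (adelicUnitaryGroup L V.Hm ⧸ adelicUnitaryRat L V.Hm)]
  (M : Subgroup (adelicUnitaryGroup L V.Hm)) {A : Type*} [Group A] [TopologicalSpace A] [IsTopologicalGroup A]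
  (π : M →* A) (hπs : Function.Surjective π) (x : adelicUnitaryGroup L V.Hm ⧸ adelicUnitaryRat L V.Hm)
  [MeasurableSpace (A ⧸ LevelOrbit.pieceLattice M (adelicUnitaryRat L V.Hm) π x)]
  [BorelSpace (A ⧸ LevelOrbit.pieceLattice M (adelicUnitaryRat L V.Hm) π x)]
  [CompactSpace (A ⧸ LevelOrbit.pieceLattice M (adelicUnitaryRat L V.Hm) π x)]

/-- **Piece projection in the END-STATE carrier** (`⟪p, v⟫ = ⟪p, p⟫` for `p = regimePieceEmb (pieceDescendCM u)`,
`v` agreeing a.e. on the piece `M • x` of `U(V)(L)\U(V)(𝔸)` — read through `regimeEquiv` — with the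
`ker π`-invariant, piecewise-continuous `u`): the input of `Gen12FunBridge.proj_of_eq_smul` (row hbr, C5′). -/
theorem inner_regimePieceEmb_left_eq_inner_regimePieceEmb (hM : IsOpen (M : Set (adelicUnitaryGroup L V.Hm)))
    (hπc : Continuous π) (hπo : IsOpenMap π) (v : (V.latticeModel hP).toQuotientModel.H)
    {u : adelicUnitaryGroup L V.Hm ⧸ adelicUnitaryRat L V.Hm → ℂ}
    (hu : ∀ n : M, π n = 1 → ∀ y, u (n • y) = u y)
    (huc : ContinuousOn u (MulAction.orbit M x))
    (hvu : ∀ᵐ y ∂(V.regimeν hP h), y ∈ MulAction.orbit M x →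
      (v : (V.latticeModel hP).toQuotientModel.G ⧸ (V.latticeModel hP).toQuotientModel.Γ → ℂ)
        (cosetCongr (regimeEquiv L V.Hm h).toMulEquiv (adelicUnitaryRat L V.Hm)
          (V.latticeModel hP).toQuotientModel.Γ (V.regimeEquiv_mem_latticeModel_Γ_iff hP h) y) = u y) :
    ⟪V.regimePieceEmb hP h M π x hM hπc
        (LevelOrbit.pieceDescendCM M (adelicUnitaryRat L V.Hm) π hM hπc hπo hπs x u hu huc), v⟫_ℂ =
      ⟪V.regimePieceEmb hP h M π x hM hπc
          (LevelOrbit.pieceDescendCM M (adelicUnitaryRat L V.Hm) π hM hπc hπo hπs x u hu huc),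
        V.regimePieceEmb hP h M π x hM hπc
          (LevelOrbit.pieceDescendCM M (adelicUnitaryRat L V.Hm) π hM hπc hπo hπs x u hu huc)⟫_ℂ :=
  QuotientModel.inner_pieceEmb_left_eq_inner_pieceEmb _ _ _ _ M π hπs x hM hπc hπo v hu huc hvu

/-- Its value: `∫_{M • x} ‖u‖² d(regimeν)`. -/
theorem inner_regimePieceEmb_pieceDescendCM_left (hM : IsOpen (M : Set (adelicUnitaryGroup L V.Hm)))
    (hπc : Continuous π) (hπo : IsOpenMap π) (v : (V.latticeModel hP).toQuotientModel.H)
    {u : adelicUnitaryGroup L V.Hm ⧸ adelicUnitaryRat L V.Hm → ℂ}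
    (hu : ∀ n : M, π n = 1 → ∀ y, u (n • y) = u y)
    (huc : ContinuousOn u (MulAction.orbit M x))
    (hvu : ∀ᵐ y ∂(V.regimeν hP h), y ∈ MulAction.orbit M x →
      (v : (V.latticeModel hP).toQuotientModel.G ⧸ (V.latticeModel hP).toQuotientModel.Γ → ℂ)
        (cosetCongr (regimeEquiv L V.Hm h).toMulEquiv (adelicUnitaryRat L V.Hm)
          (V.latticeModel hP).toQuotientModel.Γ (V.regimeEquiv_mem_latticeModel_Γ_iff hP h) y) = u y) :
    ⟪V.regimePieceEmb hP h M π x hM hπc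
        (LevelOrbit.pieceDescendCM M (adelicUnitaryRat L V.Hm) π hM hπc hπo hπs x u hu huc), v⟫_ℂ =
      ((∫ y in MulAction.orbit M x, ‖u y‖ ^ 2 ∂(V.regimeν hP h) : ℝ) : ℂ) :=
  QuotientModel.inner_pieceEmb_pieceDescendCM_left _ _ _ _ M π hπs x hM hπc hπo v hu huc hvu

/-- … and it is `≠ 0` iff `u ≢ 0` on the piece (for `regimeν` positive on open sets). -/
theorem inner_regimePieceEmb_pieceDescendCM_left_ne_zero_iff_exists [(V.regimeν hP h).IsOpenPosMeasure]
    (hM : IsOpen (M : Set (adelicUnitaryGroup L V.Hm))) (hπc : Continuous π) (hπo : IsOpenMap π)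
    (v : (V.latticeModel hP).toQuotientModel.H) {u : adelicUnitaryGroup L V.Hm ⧸ adelicUnitaryRat L V.Hm → ℂ}
    (hu : ∀ n : M, π n = 1 → ∀ y, u (n • y) = u y)
    (huc : ContinuousOn u (MulAction.orbit M x))
    (hvu : ∀ᵐ y ∂(V.regimeν hP h), y ∈ MulAction.orbit M x →
      (v : (V.latticeModel hP).toQuotientModel.G ⧸ (V.latticeModel hP).toQuotientModel.Γ → ℂ)
        (cosetCongr (regimeEquiv L V.Hm h).toMulEquiv (adelicUnitaryRat L V.Hm)
          (V.latticeModel hP).toQuotientModel.Γ (V.regimeEquiv_mem_latticeModel_Γ_iff hP h) y) = u y) :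
    ⟪V.regimePieceEmb hP h M π x hM hπc
        (LevelOrbit.pieceDescendCM M (adelicUnitaryRat L V.Hm) π hM hπc hπo hπs x u hu huc), v⟫_ℂ ≠ 0 ↔
      ∃ y ∈ MulAction.orbit M x, u y ≠ 0 :=
  haveI : ((V.latticeModel hP).toQuotientModel.pullbackν (adelicUnitaryRat L V.Hm) (regimeEquiv L V.Hm h)
      (V.regimeEquiv_mem_latticeModel_Γ_iff hP h)).IsOpenPosMeasure := ‹(V.regimeν hP h).IsOpenPosMeasure›
  QuotientModel.inner_pieceEmb_pieceDescendCM_left_ne_zero_iff_exists _ _ _ _ M π hπs x hM hπc hπo v hu huc hvu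

end HermSpace3

end HodgeCM

end
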